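import Literature.Combinatorics.Optimization.ShellLawMixedPinning
import Literature.Combinatorics.Optimization.ShellLawDeletionComparability
import Literature.Combinatorics.Optimization.ShellLawTypeStep
import HarnessLib

/-!
# Excess pinning: one edge of a class full and a second edge of the same class NOT full

Continuation of `ShellLawFullEdgeMoments.lean` / `ShellLawMixedPinning.lean` (full edges pinned) and
`ShellLawHalfPinning.lean` (half-matched vertices pinned). Fix a perfect matching (`π` its partner involution), a
`π`-stable ground set `S`, a block `H`, and a CLASS of edges of `S` given by a set `R ⊆ S` of representatives
(`v < πv` for `v ∈ R`; e.g. `R = reps(vAA_π(S,H))`, the `HH` edges). For a cut `U` write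
`n_R(U) = #{v ∈ R : v, πv ∈ U}` for the number of edges of the class lying inside `U` (spelled inline, no definition).

The cell's pair-containment form of an `H`-symmetric mask `ψ(|U∩H|)` in a GENERAL (not type-constant) direction
differs from its type-averaged direction by the DIAGONAL EXCESSES of the edge classes (prover MEMO-25 §2 / MEMO-32 §3,
lit `ShellLawTypeSortedForms`): the shell sums of `ψ(|U∩H|)·1[e ⊆ U]·(1 − 1[e′ ⊆ U])` for two distinct edges `e, e′` of
the same class, i.e. — summed over the ordered pairs of the class — of `ψ(|U∩H|)·n_R(U)·(|R| − n_R(U))`. This file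
reduces that sum EXACTLY to UNTILTED shell sums on the ground set with both edges deleted, by splitting
"`e′` not full" into "`e′` empty" and "`e′` half-matched":

* §1 `classCount_eq_sum_ite`, **`sum_shell_mul_classCount_fun_eq`** — the one-edge pin of `ShellLawMixedPinning`
  (`sum_shell_mul_hhCount_fun_eq`) for an ARBITRARY class `R`:
  `Σ_{U ∈ Shell_S(t+2,c)} F(U)·n_R(U) = Σ_{v ∈ R} Σ_{W ∈ Shell_{S∖e_v}(t,c)} F(W ∪ e_v)`.
* §2 bookkeeping: `classCount_union_pair` (`n_R(W ∪ e_v) = 1 + n_{R∖v}(W)` for `W` avoiding `e_v`),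
  `card_sub_classCount_eq_sum` (`|R′| − n_{R′}(W) = Σ_{w ∈ R′} (1 − 1[e_w ⊆ W])`), `one_sub_full_eq`
  (`1 − 1[e_w ⊆ W] = 1[e_w ∩ W = ∅] + 1[w half] + 1[πw half]`); the cuts of `Shell_S(t,c)` avoiding `e_w`
  ARE `Shell_{S∖e_w}(t,c)` (`ShellLawWeightedLevelStep.shellIn_filter_avoid_eq`).
* §3 **`sum_shell_blockStat_classCount_excess_eq`** — THE EXCESS IDENTITY:
  `Σ_{U ∈ Shell_S(t+3,c+1)} ψ(|U∩H|)·n_R(U)·(|R| − n_R(U))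
     = Σ_{v ∈ R} Σ_{w ∈ R∖v} [ Σ_{W ∈ Shell_{S∖e_v∖e_w}(t+1,c+1)} ψ(|W∩H| + σ_v)
                              + Σ_{W ∈ Shell_{S∖e_v∖e_w}(t,c)} ψ(|W∩H| + σ_v + [w∈H])
                              + Σ_{W ∈ Shell_{S∖e_v∖e_w}(t,c)} ψ(|W∩H| + σ_v + [πw∈H]) ]`,
  `σ_v = |e_v ∩ H|`: the first term is the pattern (`e_v` full, `e_w` EMPTY) — an untilted block-statistic shell
  sum at the SAME level on the doubly deleted ground set —, the last two the pattern (`e_v` full, `e_w` HALF) — shell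
  sums ONE LEVEL DOWN, i.e. carrying the half-matching probability `(c+1)/(|S|−2)`, LINEAR IN THE LEVEL and zero at
  the virtual level (the mechanism of `ShellLawHalfPinning` / the cell's brick 119).
* §4 the pattern probabilities in product form (no division): **`card_shellIn_full_empty_ratio`**
  (`|S|(|S|−2)·|Shell_{S∖e_v∖e_w}(t+1,c+1)| = (t+2−c)(|S|−t−c−4)·|Shell_S(t+3,c+1)|`) and
  **`card_shellIn_full_half_ratio`** (`|S|(|S|−2)·|Shell_{S∖e_v∖e_w}(t,c)| = (t+2−c)(c+1)·|Shell_S(t+3,c+1)|`).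
* §5 the three classes of an `H`-type: **`sum_shell_blockStat_hhCount_excess_eq`** (`R = reps(vAA)`: shifts
  `+2` and `+3, +3`), **`sum_shell_blockStat_ddCount_excess_eq`** (`R = reps(vDD)`: shifts `0` and `0, 0`),
  **`sum_shell_blockStat_mixedCount_excess_eq`** (`R = reps(vBH ∪ vBN)`: shift `+1`, and the two half terms
  together are `ψ(·+2) + ψ(·+1)`).

All PROVED, 0 sorry, no definitions, no named facts; bookkeeping on Rothvoß's slack-matrix combinatorics. Cell
pnp-psdrank (engine seat g27, MEMO-26 (eng) §1: the identity was found and checked in exact rational arithmetic —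
kit job j323383, two lineages — together with the sign of the per-matching VIRTUAL diagonal excess).

## References
* [Rothvoss2017] T. Rothvoß, *The matching polytope has exponential extension complexity*, J. ACM 64 (2017),
  §2 (PDF pp. 5–6): cuts, perfect matchings, the three edge types, the level classes.
* [GodsilMeagher2015] C. Godsil, K. Meagher, *Erdős–Ko–Rado Theorems: Algebraic Approaches*, §15.2 (perfect
  matchings as fixed-point-free involutions; edge representatives).
-/

noncomputable section

open Finset

namespace Literature.Combinatorics.Optimization

namespace ShellStep

variable {n : ℕ} {π : Fin n → Fin n}

section Excess

variable (hπ : ∀ v, π (π v) = v) (hπ' : ∀ v, π v ≠ v)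
include hπ hπ'

/-! ### §1 The number of edges of a class inside the cut, and its one-edge pin -/

omit hπ hπ' in
/-- `n_R(U) = Σ_{v ∈ R} 1[v ∈ U ∧ πv ∈ U]` (as reals). [cite: GodsilMeagher2015, §15.2] -/
theorem classCount_eq_sum_ite (R U : Finset (Fin n)) :
    (((R.filter fun v => v ∈ U ∧ π v ∈ U).card : ℕ) : ℝ) = ∑ v ∈ R, if (v ∈ U ∧ π v ∈ U) then (1 : ℝ) else 0 := by
  rw [Finset.card_filter]
  push_cast
  rfl

/-- **FIRST MOMENT of the class count against an arbitrary function of the cut**: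
`Σ_{U ∈ Shell_S(t+2,c)} F(U)·n_R(U) = Σ_{v ∈ R} Σ_{W ∈ Shell_{S∖e_v}(t,c)} F(W ∪ e_v)` for every `R ⊆ S`
(`ShellLawMixedPinning.sum_shell_mul_hhCount_fun_eq` is the case `R = reps(vAA)`).
[cite: Rothvoss2017, §2 (PDF p. 6)] [cite: GodsilMeagher2015, §15.2] -/
theorem sum_shell_mul_classCount_fun_eq {S : Finset (Fin n)} (hS : ∀ u ∈ S, π u ∈ S) {R : Finset (Fin n)}
    (hRS : R ⊆ S) (t c : ℕ) (F : Finset (Fin n) → ℝ) :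
    ∑ U ∈ shellIn π S (t + 2) c, F U * (((R.filter fun v => v ∈ U ∧ π v ∈ U).card : ℕ) : ℝ) =
      ∑ v ∈ R, ∑ W ∈ shellIn π (S \ {v, π v}) t c, F (W ∪ {v, π v}) := by
  calc ∑ U ∈ shellIn π S (t + 2) c, F U * (((R.filter fun v => v ∈ U ∧ π v ∈ U).card : ℕ) : ℝ)
      = ∑ U ∈ shellIn π S (t + 2) c, ∑ v ∈ R, (if (v ∈ U ∧ π v ∈ U) then F U else 0) := by
        refine sum_congr rfl fun U _ => ?_
        rw [classCount_eq_sum_ite, mul_sum]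
        exact sum_congr rfl fun v _ => by split_ifs <;> simp
    _ = ∑ v ∈ R, ∑ U ∈ shellIn π S (t + 2) c, (if (v ∈ U ∧ π v ∈ U) then F U else 0) := sum_comm
    _ = ∑ v ∈ R, ∑ U ∈ (shellIn π S (t + 2) c).filter (fun U => v ∈ U ∧ π v ∈ U), F U := by
        refine sum_congr rfl fun v _ => ?_
        rw [sum_filter]
    _ = _ := sum_congr rfl fun v hv => sum_shell_pin_one_eq_fun hπ hπ' hS (hRS hv) t c F

/-! ### §2 Bookkeeping: adjoining a full edge, the non-full count, the avoid/half split -/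

omit hπ' in
/-- Two distinct representatives span DISJOINT edges: for `v < πv`, `w < πw`, `w ≠ v` one has `w ∉ e_v` and `πw ∉ e_v`.
[cite: GodsilMeagher2015, §15.2] -/
theorem reps_edges_disjoint {v w : Fin n} (hv : v < π v) (hw : w < π w) (hwv : w ≠ v) :
    w ≠ v ∧ w ≠ π v ∧ π w ≠ v ∧ π w ≠ π v := by
  refine ⟨hwv, fun h => ?_, fun h => ?_, fun h => hwv ?_⟩
  · -- `w = πv` gives `πw = v`, contradicting the two orderings
    have hπw : π w = v := by rw [h, hπ]
    rw [hπw] at hw; rw [← h] at hv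
    exact lt_asymm hv hw
  · have hw' : w = π v := by rw [← h, hπ]
    have hπw : π w = v := h
    rw [hπw] at hw; rw [← hw'] at hv
    exact lt_asymm hv hw
  · have := congrArg π h
    rwa [hπ, hπ] at this

omit hπ' in
/-- **Adjoining a full edge of the class**: for `W` avoiding `e_v` and `v ∈ R` a representative class,
`n_R(W ∪ e_v) = 1 + n_{R∖v}(W)`. [cite: GodsilMeagher2015, §15.2] -/
theorem classCount_union_pair {R W : Finset (Fin n)} (hR : ∀ u ∈ R, u < π u) {v : Fin n} (hv : v ∈ R)
    (hvW : v ∉ W) (hπvW : π v ∉ W) :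
    ((R.filter fun u => u ∈ W ∪ {v, π v} ∧ π u ∈ W ∪ {v, π v}).card : ℕ) =
      1 + ((R.erase v).filter fun u => u ∈ W ∧ π u ∈ W).card := by
  classical
  have hsplit : (R.filter fun u => u ∈ W ∪ {v, π v} ∧ π u ∈ W ∪ {v, π v}) =
      insert v ((R.erase v).filter fun u => u ∈ W ∧ π u ∈ W) := by
    ext u
    simp only [mem_filter, mem_insert, mem_erase, mem_union, mem_singleton]
    constructor
    · rintro ⟨huR, hu1, hu2⟩
      by_cases huv : u = v
      · exact Or.inl huv
      · right
        obtain ⟨-, h2, h3, h4⟩ := reps_edges_disjoint hπ (hR v hv) (hR u huR) huv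
        refine ⟨⟨huv, huR⟩, ?_, ?_⟩
        · rcases hu1 with h | h | h
          · exact h
          · exact absurd h huv
          · exact absurd h h2
        · rcases hu2 with h | h | h
          · exact h
          · exact absurd h h3
          · exact absurd h h4
    · rintro (rfl | ⟨⟨huv, huR⟩, hu1, hu2⟩)
      · exact ⟨hv, Or.inr (Or.inl rfl), Or.inr (Or.inr rfl)⟩
      · exact ⟨huR, Or.inl hu1, Or.inl hu2⟩
  rw [hsplit, card_insert_of_notMem, Nat.add_comm]
  simp only [mem_filter, mem_erase, not_and]
  exact fun h => absurd rfl h.1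

omit hπ hπ' in
/-- **The non-full count is a sum of indicators**: `|R′| − n_{R′}(W) = Σ_{w ∈ R′} (1 − 1[w ∈ W ∧ πw ∈ W])`.
[cite: GodsilMeagher2015, §15.2] -/
theorem card_sub_classCount_eq_sum (R' W : Finset (Fin n)) :
    (R'.card : ℝ) - (((R'.filter fun u => u ∈ W ∧ π u ∈ W).card : ℕ) : ℝ) =
      ∑ w ∈ R', (1 - (if (w ∈ W ∧ π w ∈ W) then (1 : ℝ) else 0)) := by
  rw [sum_sub_distrib, sum_const, nsmul_eq_mul, mul_one, classCount_eq_sum_ite]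

omit hπ' in
/-- **The three ways of not being full**: `1 − 1[w,πw ∈ W] = 1[w,πw ∉ W] + 1[w ∈ W, πw ∉ W] + 1[w ∉ W, πw ∈ W]`.
[cite: Rothvoss2017, §2 (PDF p. 5)] -/
theorem one_sub_full_eq (W : Finset (Fin n)) (w : Fin n) :
    (1 : ℝ) - (if (w ∈ W ∧ π w ∈ W) then (1 : ℝ) else 0) =
      (if (w ∉ W ∧ π w ∉ W) then (1 : ℝ) else 0) + (if (w ∈ W ∧ π w ∉ W) then (1 : ℝ) else 0) +
        (if (π w ∈ W ∧ π (π w) ∉ W) then (1 : ℝ) else 0) := by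
  rw [hπ]
  by_cases h1 : w ∈ W <;> by_cases h2 : π w ∈ W <;> simp [h1, h2]

omit hπ hπ' in
/-- Adjoining a disjoint pair to a cut adds its `H`-content to the block count:
`|(W ∪ e_v) ∩ H| = |W ∩ H| + |e_v ∩ H|` when `v, πv ∉ W`. [cite: Rothvoss2017, §2 (PDF p. 5)] -/
theorem card_union_pair_inter_cast (H : Finset (Fin n)) {W : Finset (Fin n)} {v : Fin n} (hvW : v ∉ W)
    (hπvW : π v ∉ W) :
    (((W ∪ {v, π v}) ∩ H).card : ℤ) = ((W ∩ H).card : ℤ) + ((({v, π v} : Finset (Fin n)) ∩ H).card : ℤ) := by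
  have hdisj : Disjoint (W ∩ H) (({v, π v} : Finset (Fin n)) ∩ H) := by
    refine disjoint_left.2 fun u hu hu' => ?_
    have huW := (mem_inter.1 hu).1
    rcases mem_insert.1 (mem_inter.1 hu').1 with rfl | h
    · exact hvW huW
    · rw [mem_singleton] at h; subst h; exact hπvW huW
  rw [union_inter_distrib_right, card_union_of_disjoint hdisj]
  push_cast
  ring

/-! ### §3 The excess identity -/

/-- The inner step at a deleted ground set: for `S′` `π`-stable, `w ∈ S′`, and any shift `σ`,
`Σ_{W ∈ Shell_{S′}(t+1,c+1)} ψ(|W∩H| + σ)·(1 − 1[e_w ⊆ W])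
  = Σ_{W′ ∈ Shell_{S′∖e_w}(t+1,c+1)} ψ(|W′∩H| + σ) + Σ_{W′ ∈ Shell_{S′∖e_w}(t,c)} ψ(|W′∩H| + σ + [w∈H])
    + Σ_{W′ ∈ Shell_{S′∖e_w}(t,c)} ψ(|W′∩H| + σ + [πw∈H])`. [cite: Rothvoss2017, §2 (PDF p. 6)] -/
theorem sum_shell_blockStat_one_sub_full_eq {S' : Finset (Fin n)} (hS' : ∀ u ∈ S', π u ∈ S') (H : Finset (Fin n))
    {w : Fin n} (hw : w ∈ S') (t c : ℕ) (ψ : ℤ → ℝ) (σ : ℤ) :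
    ∑ W ∈ shellIn π S' (t + 1) (c + 1), ψ (((W ∩ H).card : ℤ) + σ) * (1 - (if (w ∈ W ∧ π w ∈ W) then (1 : ℝ) else 0)) =
      (∑ W' ∈ shellIn π (S' \ {w, π w}) (t + 1) (c + 1), ψ (((W' ∩ H).card : ℤ) + σ)) +
        (∑ W' ∈ shellIn π (S' \ {w, π w}) t c, ψ (((W' ∩ H).card : ℤ) + σ + (if w ∈ H then 1 else 0))) +
        (∑ W' ∈ shellIn π (S' \ {w, π w}) t c, ψ (((W' ∩ H).card : ℤ) + σ + (if π w ∈ H then 1 else 0))) := by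
  classical
  have hπw : π w ∈ S' := hS' w hw
  -- split `1 − 1[full]` into the three patterns and distribute
  have hsplit : ∑ W ∈ shellIn π S' (t + 1) (c + 1),
      ψ (((W ∩ H).card : ℤ) + σ) * (1 - (if (w ∈ W ∧ π w ∈ W) then (1 : ℝ) else 0)) =
      (∑ W ∈ shellIn π S' (t + 1) (c + 1), if (w ∉ W ∧ π w ∉ W) then ψ (((W ∩ H).card : ℤ) + σ) else 0) +
      (∑ W ∈ shellIn π S' (t + 1) (c + 1), if (w ∈ W ∧ π w ∉ W) then ψ (((W ∩ H).card : ℤ) + σ) else 0) +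
      (∑ W ∈ shellIn π S' (t + 1) (c + 1), if (π w ∈ W ∧ π (π w) ∉ W) then ψ (((W ∩ H).card : ℤ) + σ) else 0) := by
    rw [← sum_add_distrib, ← sum_add_distrib]
    refine sum_congr rfl fun W _ => ?_
    rw [one_sub_full_eq hπ W w]
    split_ifs <;> ring
  rw [hsplit]
  congr 1
  congr 1
  · -- the avoiding pattern
    rw [← sum_filter, shellIn_filter_avoid_eq]
  · -- `w` half-matched
    rw [← sum_filter, sum_shellIn_half_eq hπ hπ' hw t c]
    refine sum_congr rfl fun W' hW' => ?_
    have hwW' : w ∉ W' := fun h => by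
      have := mem_sdiff.1 ((mem_shellIn.1 hW').1 h); simp at this
    rw [card_insert_inter_cast H hwW']
    congr 1; ring
  · -- `πw` half-matched
    rw [← sum_filter, sum_shellIn_half_eq hπ hπ' hπw t c]
    have hset : S' \ {π w, π (π w)} = S' \ {w, π w} := by rw [hπ, pair_comm]
    rw [hset]
    refine sum_congr rfl fun W' hW' => ?_
    have hwW' : π w ∉ W' := fun h => by
      have := mem_sdiff.1 ((mem_shellIn.1 hW').1 h); simp at this
    rw [card_insert_inter_cast H hwW']
    congr 1; ring

/-- **THE EXCESS IDENTITY.** For a `π`-stable ground set `S`, a block `H`, a class of edges of `S` with representative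
set `R ⊆ S` (`v < πv` on `R`), and every `ψ : ℤ → ℝ`:
`Σ_{U ∈ Shell_S(t+3,c+1)} ψ(|U∩H|)·n_R(U)·(|R| − n_R(U))
   = Σ_{v ∈ R} Σ_{w ∈ R∖v} [ Σ_{W ∈ Shell_{S∖e_v∖e_w}(t+1,c+1)} ψ(|W∩H| + σ_v)
       + Σ_{W ∈ Shell_{S∖e_v∖e_w}(t,c)} ψ(|W∩H| + σ_v + [w∈H]) + Σ_{W ∈ Shell_{S∖e_v∖e_w}(t,c)} ψ(|W∩H| + σ_v + [πw∈H]) ]`,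
`σ_v = |e_v ∩ H|`: one edge of the class pinned FULL (the one-edge pin), a second edge of the class pinned EMPTY
(same level, doubly deleted ground set) or HALF (one level and one vertex down).
[cite: Rothvoss2017, §2 (PDF p. 6)] [cite: GodsilMeagher2015, §15.2] -/
theorem sum_shell_blockStat_classCount_excess_eq {S : Finset (Fin n)} (hS : ∀ u ∈ S, π u ∈ S) (H : Finset (Fin n))
    {R : Finset (Fin n)} (hRS : R ⊆ S) (hR : ∀ v ∈ R, v < π v) (t c : ℕ) (ψ : ℤ → ℝ) :
    ∑ U ∈ shellIn π S (t + 3) (c + 1), ψ ((U ∩ H).card : ℤ) *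
        ((((R.filter fun v => v ∈ U ∧ π v ∈ U).card : ℕ) : ℝ) *
          ((R.card : ℝ) - (((R.filter fun v => v ∈ U ∧ π v ∈ U).card : ℕ) : ℝ))) =
      ∑ v ∈ R, ∑ w ∈ R.erase v,
        ((∑ W ∈ shellIn π ((S \ {v, π v}) \ {w, π w}) (t + 1) (c + 1),
            ψ (((W ∩ H).card : ℤ) + ((({v, π v} : Finset (Fin n)) ∩ H).card : ℤ))) +
          (∑ W ∈ shellIn π ((S \ {v, π v}) \ {w, π w}) t c,
            ψ (((W ∩ H).card : ℤ) + ((({v, π v} : Finset (Fin n)) ∩ H).card : ℤ) + (if w ∈ H then 1 else 0))) +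
          (∑ W ∈ shellIn π ((S \ {v, π v}) \ {w, π w}) t c,
            ψ (((W ∩ H).card : ℤ) + ((({v, π v} : Finset (Fin n)) ∩ H).card : ℤ) + (if π w ∈ H then 1 else 0)))) := by
  classical
  -- STEP 1: pin one full edge of the class (§1 with `F(U) = ψ(|U∩H|)·(|R| − n_R(U))`)
  have h1 := sum_shell_mul_classCount_fun_eq hπ hπ' hS hRS (t + 1) (c + 1)
    (fun U => ψ ((U ∩ H).card : ℤ) * ((R.card : ℝ) - (((R.filter fun v => v ∈ U ∧ π v ∈ U).card : ℕ) : ℝ)))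
  have e0 : ∑ U ∈ shellIn π S (t + 3) (c + 1), ψ ((U ∩ H).card : ℤ) *
      ((((R.filter fun v => v ∈ U ∧ π v ∈ U).card : ℕ) : ℝ) *
        ((R.card : ℝ) - (((R.filter fun v => v ∈ U ∧ π v ∈ U).card : ℕ) : ℝ))) =
      ∑ U ∈ shellIn π S (t + 1 + 2) (c + 1), (ψ ((U ∩ H).card : ℤ) *
        ((R.card : ℝ) - (((R.filter fun v => v ∈ U ∧ π v ∈ U).card : ℕ) : ℝ))) *
        (((R.filter fun v => v ∈ U ∧ π v ∈ U).card : ℕ) : ℝ) := by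
    rw [show t + 1 + 2 = t + 3 by ring]
    exact sum_congr rfl fun U _ => by ring
  rw [e0, h1]
  refine sum_congr rfl fun v hv => ?_
  have hvS : v ∈ S := hRS hv
  set S' := S \ {v, π v} with hS'def
  have hS' : ∀ u ∈ S', π u ∈ S' := by
    intro u hu
    simp only [hS'def, mem_sdiff, mem_insert, mem_singleton, not_or] at hu ⊢
    refine ⟨hS u hu.1, fun h => hu.2.2 ?_, fun h => hu.2.1 ?_⟩
    · rw [← h, hπ]
    · have := congrArg π h; rwa [hπ, hπ] at this
  -- STEP 2: on `W ∈ Shell_{S'}(t+1,c+1)`: `|R| − n_R(W ∪ e_v) = Σ_{w ∈ R∖v} (1 − 1[e_w ⊆ W])`, `|(W ∪ e_v) ∩ H| = |W∩H| + σ_v`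
  have hstep2 : ∀ W ∈ shellIn π S' (t + 1) (c + 1),
      ψ (((W ∪ {v, π v}) ∩ H).card : ℤ) *
          ((R.card : ℝ) - (((R.filter fun u => u ∈ W ∪ {v, π v} ∧ π u ∈ W ∪ {v, π v}).card : ℕ) : ℝ)) =
        ∑ w ∈ R.erase v, ψ (((W ∩ H).card : ℤ) + ((({v, π v} : Finset (Fin n)) ∩ H).card : ℤ)) *
          (1 - (if (w ∈ W ∧ π w ∈ W) then (1 : ℝ) else 0)) := by
    intro W hW
    have hWS' : W ⊆ S' := (mem_shellIn.1 hW).1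
    have hvW : v ∉ W := fun h => by have := mem_sdiff.1 (hWS' h); simp at this
    have hπvW : π v ∉ W := fun h => by have := mem_sdiff.1 (hWS' h); simp at this
    rw [card_union_pair_inter_cast H hvW hπvW, classCount_union_pair hπ hR hv hvW hπvW, ← mul_sum]
    congr 1
    rw [← card_sub_classCount_eq_sum, card_erase_of_mem hv]
    have h1R : 1 ≤ R.card := card_pos.2 ⟨v, hv⟩
    push_cast [Nat.cast_sub h1R]
    ring
  rw [sum_congr rfl hstep2, sum_comm]
  refine sum_congr rfl fun w hw => ?_
  -- STEP 3: the inner identity at the deleted ground set `S'` (`w ∈ S'` since the edges are disjoint)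
  have hwR : w ∈ R := (mem_erase.1 hw).2
  obtain ⟨h1, h2, -, -⟩ := reps_edges_disjoint hπ (hR v hv) (hR w hwR) (mem_erase.1 hw).1
  have hwS' : w ∈ S' := by
    simp only [hS'def, mem_sdiff, mem_insert, mem_singleton, not_or]
    exact ⟨hRS hwR, h1, h2⟩
  exact sum_shell_blockStat_one_sub_full_eq hπ hπ' hS' H hwS' t c ψ _

/-! ### §4 The two pattern probabilities (product form) -/

/-- **Probability of the pattern (`e_v` full, `e_w` empty)**, product form: for distinct representatives `v, w` of
edges of `S`, `|S|·(|S|−2)·|Shell_{S∖e_v∖e_w}(t+1,c+1)| = (t+2−c)·(|S|−t−c−4)·|Shell_S(t+3,c+1)|`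
(full: `(t+3−(c+1))/|S|`, then empty in the deleted ground set: `(|S|−2−(t+1)−(c+1))/(|S|−2)`).
[cite: Rothvoss2017, §2 (PDF p. 6)] -/
theorem card_shellIn_full_empty_ratio {S : Finset (Fin n)} (hS : ∀ u ∈ S, π u ∈ S) {v w : Fin n} (hv : v ∈ S)
    (hvlt : v < π v) (hwS : w ∈ S) (hwlt : w < π w) (hwv : w ≠ v) (t c : ℕ) :
    (S.card : ℝ) * ((S.card : ℝ) - 2) * (shellIn π ((S \ {v, π v}) \ {w, π w}) (t + 1) (c + 1)).card =
      ((t : ℝ) + 2 - c) * ((S.card : ℝ) - t - c - 4) * (shellIn π S (t + 3) (c + 1)).card := by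
  set S' := S \ {v, π v} with hS'def
  have hS' : ∀ u ∈ S', π u ∈ S' := by
    intro u hu
    simp only [hS'def, mem_sdiff, mem_insert, mem_singleton, not_or] at hu ⊢
    refine ⟨hS u hu.1, fun h => hu.2.2 ?_, fun h => hu.2.1 ?_⟩
    · rw [← h, hπ]
    · have := congrArg π h; rwa [hπ, hπ] at this
  obtain ⟨h1, h2, -, -⟩ := reps_edges_disjoint hπ hvlt hwlt hwv
  have hwS' : w ∈ S' := by
    simp only [hS'def, mem_sdiff, mem_insert, mem_singleton, not_or]; exact ⟨hwS, h1, h2⟩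
  have hcardS' : (S'.card : ℝ) = S.card - 2 := by
    have hsub : ({v, π v} : Finset (Fin n)) ⊆ S := by
      intro u hu; rcases mem_insert.1 hu with rfl | h
      · exact hv
      · rw [mem_singleton] at h; subst h; exact hS v hv
    rw [hS'def, card_sdiff_of_subset hsub, card_pair (hπ' v).symm]
    have := card_le_card hsub; rw [card_pair (hπ' v).symm] at this
    push_cast [Nat.cast_sub this]; ring
  have hfull := card_shellIn_sdiff_pair_ratio hπ hπ' hS hv (t + 1) (c + 1)
  rw [← hS'def, show t + 1 + 2 = t + 3 by ring] at hfull
  have havoid := card_shellIn_sdiff_pair_avoid_ratio hπ hπ' hS' hwS' (t + 1) (c + 1)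
  rw [hcardS'] at havoid
  -- `|S|(|S|−2)|Sh''| = |S|·((|S|−2)|Sh''|) = |S|·(|S|−2−(t+1)−(c+1))|Sh'| = (|S|−t−c−4)·(|S||Sh'|) = …`
  have e1 : (S.card : ℝ) * ((S.card : ℝ) - 2) * (shellIn π (S' \ {w, π w}) (t + 1) (c + 1)).card =
      (S.card : ℝ) * (((S.card : ℝ) - 2) * (shellIn π (S' \ {w, π w}) (t + 1) (c + 1)).card) := by ring
  rw [e1, havoid]
  push_cast at hfull ⊢
  linear_combination ((S.card : ℝ) - (t : ℝ) - (c : ℝ) - 4) * hfull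

/-- **Probability of the pattern (`e_v` full, `e_w` half)**, product form: for distinct representatives `v, w` of
edges of `S`, `|S|·(|S|−2)·|Shell_{S∖e_v∖e_w}(t,c)| = (t+2−c)·(c+1)·|Shell_S(t+3,c+1)|`
(full: `(t+3−(c+1))/|S|`, then half at a given vertex of `e_w`: `(c+1)/(|S|−2)`) — LINEAR IN THE LEVEL `c+1`.
[cite: Rothvoss2017, §2 (PDF p. 6)] -/
theorem card_shellIn_full_half_ratio {S : Finset (Fin n)} (hS : ∀ u ∈ S, π u ∈ S) {v w : Fin n} (hv : v ∈ S)
    (hvlt : v < π v) (hwS : w ∈ S) (hwlt : w < π w) (hwv : w ≠ v) (t c : ℕ) :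
    (S.card : ℝ) * ((S.card : ℝ) - 2) * (shellIn π ((S \ {v, π v}) \ {w, π w}) t c).card =
      ((t : ℝ) + 2 - c) * ((c : ℝ) + 1) * (shellIn π S (t + 3) (c + 1)).card := by
  set S' := S \ {v, π v} with hS'def
  have hS' : ∀ u ∈ S', π u ∈ S' := by
    intro u hu
    simp only [hS'def, mem_sdiff, mem_insert, mem_singleton, not_or] at hu ⊢
    refine ⟨hS u hu.1, fun h => hu.2.2 ?_, fun h => hu.2.1 ?_⟩
    · rw [← h, hπ]
    · have := congrArg π h; rwa [hπ, hπ] at this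
  obtain ⟨h1, h2, -, -⟩ := reps_edges_disjoint hπ hvlt hwlt hwv
  have hwS' : w ∈ S' := by
    simp only [hS'def, mem_sdiff, mem_insert, mem_singleton, not_or]; exact ⟨hwS, h1, h2⟩
  have hcardS' : (S'.card : ℝ) = S.card - 2 := by
    have hsub : ({v, π v} : Finset (Fin n)) ⊆ S := by
      intro u hu; rcases mem_insert.1 hu with rfl | h
      · exact hv
      · rw [mem_singleton] at h; subst h; exact hS v hv
    rw [hS'def, card_sdiff_of_subset hsub, card_pair (hπ' v).symm]
    have := card_le_card hsub; rw [card_pair (hπ' v).symm] at this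
    push_cast [Nat.cast_sub this]; ring
  have hfull := card_shellIn_sdiff_pair_ratio hπ hπ' hS hv (t + 1) (c + 1)
  rw [← hS'def, show t + 1 + 2 = t + 3 by ring] at hfull
  have hhalf := card_shellIn_sdiff_pair_half_ratio hπ hπ' hS' hwS' t c
  rw [hcardS'] at hhalf
  have e1 : (S.card : ℝ) * ((S.card : ℝ) - 2) * (shellIn π (S' \ {w, π w}) t c).card =
      (S.card : ℝ) * (((S.card : ℝ) - 2) * (shellIn π (S' \ {w, π w}) t c).card) := by ring
  rw [e1, hhalf]
  push_cast at hfull ⊢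
  linear_combination ((c : ℝ) + 1) * hfull

/-! ### §5 The three edge classes of an `H`-type -/

omit hπ in
/-- Representatives of `HH` edges: `|e_v ∩ H| = 2`, and every vertex of another `HH` edge lies in `H`.
[cite: Rothvoss2017, §2 (PDF p. 5)] -/
theorem pair_inter_card_of_vAA {S H : Finset (Fin n)} {v : Fin n} (hv : v ∈ reps π (vAA π S H)) :
    ((({v, π v} : Finset (Fin n)) ∩ H).card : ℤ) = 2 := by
  obtain ⟨hvA, _⟩ := mem_reps.1 hv
  obtain ⟨_, hvH, hπvH⟩ := mem_vAA.1 hvA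
  have : (({v, π v} : Finset (Fin n)) ∩ H) = {v, π v} := by
    refine inter_eq_left.2 fun u hu => ?_
    rcases mem_insert.1 hu with rfl | h
    · exact hvH
    · rw [mem_singleton] at h; subst h; exact hπvH
  rw [this, card_pair (hπ' v).symm]; rfl

omit hπ hπ' in
/-- Representatives of `H̄H̄` edges: `|e_v ∩ H| = 0`. [cite: Rothvoss2017, §2 (PDF p. 5)] -/
theorem pair_inter_card_of_vDD {S H : Finset (Fin n)} {v : Fin n} (hv : v ∈ reps π (vDD π S H)) :
    ((({v, π v} : Finset (Fin n)) ∩ H).card : ℤ) = 0 := by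
  obtain ⟨hvD, _⟩ := mem_reps.1 hv
  simp only [vDD, mem_filter] at hvD
  obtain ⟨_, hvH, hπvH⟩ := hvD
  have : (({v, π v} : Finset (Fin n)) ∩ H) = ∅ := by
    refine eq_empty_of_forall_notMem fun u hu => ?_
    obtain ⟨hu1, hu2⟩ := mem_inter.1 hu
    rcases mem_insert.1 hu1 with rfl | h
    · exact hvH hu2
    · rw [mem_singleton] at h; subst h; exact hπvH hu2
  rw [this, card_empty]; rfl

omit hπ in
/-- Representatives of mixed edges: `|e_v ∩ H| = 1` and `[v ∈ H] + [πv ∈ H] = 1`. [cite: Rothvoss2017, §2 (PDF p. 5)] -/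
theorem pair_inter_card_of_mixed {S H : Finset (Fin n)} {v : Fin n} (hv : v ∈ reps π (vBH π S H ∪ vBN π S H)) :
    ((({v, π v} : Finset (Fin n)) ∩ H).card : ℤ) = 1 ∧
      ((if v ∈ H then (1 : ℤ) else 0) + (if π v ∈ H then (1 : ℤ) else 0) = 1) := by
  obtain ⟨hvB, _⟩ := mem_reps.1 hv
  have hne : v ≠ π v := (hπ' v).symm
  rcases mem_union.1 hvB with h | h
  · simp only [vBH, mem_filter] at h
    obtain ⟨_, hvH, hπvH⟩ := h
    have : (({v, π v} : Finset (Fin n)) ∩ H) = {v} := by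
      ext u; simp only [mem_inter, mem_insert, mem_singleton]
      constructor
      · rintro ⟨rfl | rfl, hu⟩
        · rfl
        · exact absurd hu hπvH
      · rintro rfl; exact ⟨Or.inl rfl, hvH⟩
    rw [this, card_singleton]
    exact ⟨rfl, by simp [hvH, hπvH]⟩
  · simp only [vBN, mem_filter] at h
    obtain ⟨_, hvH, hπvH⟩ := h
    have : (({v, π v} : Finset (Fin n)) ∩ H) = {π v} := by
      ext u; simp only [mem_inter, mem_insert, mem_singleton]
      constructor
      · rintro ⟨rfl | rfl, hu⟩
        · exact absurd hu hvH
        · rfl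
      · rintro rfl; exact ⟨Or.inr rfl, hπvH⟩
    rw [this, card_singleton]
    exact ⟨rfl, by simp [hvH, hπvH]⟩

omit hπ hπ' in
/-- A representative set is a set of representatives: `v < πv` on `reps π C`, and `reps π C ⊆ C`.
[cite: GodsilMeagher2015, §15.2] -/
theorem reps_lt_and_subset (C : Finset (Fin n)) : (∀ v ∈ reps π C, v < π v) ∧ reps π C ⊆ C :=
  ⟨fun _ hv => (mem_reps.1 hv).2, fun _ hv => (mem_reps.1 hv).1⟩

/-- **The `HH` excess**: with `n_A(U) = #{v ∈ reps(vAA) : v, πv ∈ U}` and `a = |reps(vAA)|`,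
`Σ_{U ∈ Shell_S(t+3,c+1)} ψ(|U∩H|)·n_A(U)·(a − n_A(U))
   = Σ_{v} Σ_{w ≠ v} [ Σ_{W ∈ Shell_{S∖e_v∖e_w}(t+1,c+1)} ψ(|W∩H| + 2) + 2·Σ_{W ∈ Shell_{S∖e_v∖e_w}(t,c)} ψ(|W∩H| + 3) ]`.
[cite: Rothvoss2017, §2 (PDF p. 6)] [cite: GodsilMeagher2015, §15.2] -/
theorem sum_shell_blockStat_hhCount_excess_eq {S : Finset (Fin n)} (hS : ∀ u ∈ S, π u ∈ S) (H : Finset (Fin n))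
    (t c : ℕ) (ψ : ℤ → ℝ) :
    ∑ U ∈ shellIn π S (t + 3) (c + 1), ψ ((U ∩ H).card : ℤ) *
        (((((reps π (vAA π S H)).filter fun v => v ∈ U ∧ π v ∈ U).card : ℕ) : ℝ) *
          (((reps π (vAA π S H)).card : ℝ) -
            ((((reps π (vAA π S H)).filter fun v => v ∈ U ∧ π v ∈ U).card : ℕ) : ℝ))) =
      ∑ v ∈ reps π (vAA π S H), ∑ w ∈ (reps π (vAA π S H)).erase v,
        ((∑ W ∈ shellIn π ((S \ {v, π v}) \ {w, π w}) (t + 1) (c + 1), ψ (((W ∩ H).card : ℤ) + 2)) +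
          2 * (∑ W ∈ shellIn π ((S \ {v, π v}) \ {w, π w}) t c, ψ (((W ∩ H).card : ℤ) + 3))) := by
  obtain ⟨hR, hRA⟩ := reps_lt_and_subset (π := π) (vAA π S H)
  have hRS : reps π (vAA π S H) ⊆ S := fun v hv => (mem_vAA.1 (hRA hv)).1
  rw [sum_shell_blockStat_classCount_excess_eq hπ hπ' hS H hRS hR t c ψ]
  refine sum_congr rfl fun v hv => sum_congr rfl fun w hw => ?_
  have hwA : w ∈ reps π (vAA π S H) := (mem_erase.1 hw).2
  obtain ⟨_, hwH, hπwH⟩ := mem_vAA.1 (hRA hwA)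
  rw [pair_inter_card_of_vAA hπ' hv, if_pos hwH, if_pos hπwH, two_mul]
  have e : ∑ W ∈ shellIn π ((S \ {v, π v}) \ {w, π w}) t c, ψ (((W ∩ H).card : ℤ) + 2 + 1) =
      ∑ W ∈ shellIn π ((S \ {v, π v}) \ {w, π w}) t c, ψ (((W ∩ H).card : ℤ) + 3) :=
    sum_congr rfl fun W _ => by congr 1
  rw [e, add_assoc]

/-- **The `H̄H̄` excess**: with `n_D(U) = #{v ∈ reps(vDD) : v, πv ∈ U}` and `d = |reps(vDD)|`,
`Σ_{U ∈ Shell_S(t+3,c+1)} ψ(|U∩H|)·n_D(U)·(d − n_D(U))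
   = Σ_{v} Σ_{w ≠ v} [ Σ_{W ∈ Shell_{S∖e_v∖e_w}(t+1,c+1)} ψ(|W∩H|) + 2·Σ_{W ∈ Shell_{S∖e_v∖e_w}(t,c)} ψ(|W∩H|) ]`.
[cite: Rothvoss2017, §2 (PDF p. 6)] [cite: GodsilMeagher2015, §15.2] -/
theorem sum_shell_blockStat_ddCount_excess_eq {S : Finset (Fin n)} (hS : ∀ u ∈ S, π u ∈ S) (H : Finset (Fin n))
    (t c : ℕ) (ψ : ℤ → ℝ) :
    ∑ U ∈ shellIn π S (t + 3) (c + 1), ψ ((U ∩ H).card : ℤ) *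
        (((((reps π (vDD π S H)).filter fun v => v ∈ U ∧ π v ∈ U).card : ℕ) : ℝ) *
          (((reps π (vDD π S H)).card : ℝ) -
            ((((reps π (vDD π S H)).filter fun v => v ∈ U ∧ π v ∈ U).card : ℕ) : ℝ))) =
      ∑ v ∈ reps π (vDD π S H), ∑ w ∈ (reps π (vDD π S H)).erase v,
        ((∑ W ∈ shellIn π ((S \ {v, π v}) \ {w, π w}) (t + 1) (c + 1), ψ ((W ∩ H).card : ℤ)) +
          2 * (∑ W ∈ shellIn π ((S \ {v, π v}) \ {w, π w}) t c, ψ ((W ∩ H).card : ℤ))) := by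
  obtain ⟨hR, hRD⟩ := reps_lt_and_subset (π := π) (vDD π S H)
  have hRS : reps π (vDD π S H) ⊆ S := fun v hv => by
    have := hRD hv; simp only [vDD, mem_filter] at this; exact this.1
  rw [sum_shell_blockStat_classCount_excess_eq hπ hπ' hS H hRS hR t c ψ]
  refine sum_congr rfl fun v hv => sum_congr rfl fun w hw => ?_
  have hwD : w ∈ reps π (vDD π S H) := (mem_erase.1 hw).2
  have hw' := hRD hwD
  simp only [vDD, mem_filter] at hw'
  obtain ⟨_, hwH, hπwH⟩ := hw'
  rw [pair_inter_card_of_vDD hv, if_neg hwH, if_neg hπwH, two_mul]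
  simp only [add_zero]
  ring

/-- **The mixed excess**: with `n_B(U) = #{v ∈ reps(vBH ∪ vBN) : v, πv ∈ U}` and `b = |reps(vBH ∪ vBN)|`,
`Σ_{U ∈ Shell_S(t+3,c+1)} ψ(|U∩H|)·n_B(U)·(b − n_B(U))
   = Σ_{v} Σ_{w ≠ v} [ Σ_{W ∈ Shell_{S∖e_v∖e_w}(t+1,c+1)} ψ(|W∩H| + 1)
       + Σ_{W ∈ Shell_{S∖e_v∖e_w}(t,c)} ψ(|W∩H| + 2) + Σ_{W ∈ Shell_{S∖e_v∖e_w}(t,c)} ψ(|W∩H| + 1) ]`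
(the half-matched vertex of the mixed edge `e_w` is its `H`-endpoint or its other endpoint).
[cite: Rothvoss2017, §2 (PDF p. 6)] [cite: GodsilMeagher2015, §15.2] -/
theorem sum_shell_blockStat_mixedCount_excess_eq {S : Finset (Fin n)} (hS : ∀ u ∈ S, π u ∈ S) (H : Finset (Fin n))
    (t c : ℕ) (ψ : ℤ → ℝ) :
    ∑ U ∈ shellIn π S (t + 3) (c + 1), ψ ((U ∩ H).card : ℤ) *
        (((((reps π (vBH π S H ∪ vBN π S H)).filter fun v => v ∈ U ∧ π v ∈ U).card : ℕ) : ℝ) *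
          (((reps π (vBH π S H ∪ vBN π S H)).card : ℝ) -
            ((((reps π (vBH π S H ∪ vBN π S H)).filter fun v => v ∈ U ∧ π v ∈ U).card : ℕ) : ℝ))) =
      ∑ v ∈ reps π (vBH π S H ∪ vBN π S H), ∑ w ∈ (reps π (vBH π S H ∪ vBN π S H)).erase v,
        ((∑ W ∈ shellIn π ((S \ {v, π v}) \ {w, π w}) (t + 1) (c + 1), ψ (((W ∩ H).card : ℤ) + 1)) +
          (∑ W ∈ shellIn π ((S \ {v, π v}) \ {w, π w}) t c, ψ (((W ∩ H).card : ℤ) + 2)) +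
          (∑ W ∈ shellIn π ((S \ {v, π v}) \ {w, π w}) t c, ψ (((W ∩ H).card : ℤ) + 1))) := by
  obtain ⟨hR, hRB⟩ := reps_lt_and_subset (π := π) (vBH π S H ∪ vBN π S H)
  have hRS : reps π (vBH π S H ∪ vBN π S H) ⊆ S := fun v hv => by
    have := hRB hv
    rcases mem_union.1 this with h | h
    · simp only [vBH, mem_filter] at h; exact h.1
    · simp only [vBN, mem_filter] at h; exact h.1
  rw [sum_shell_blockStat_classCount_excess_eq hπ hπ' hS H hRS hR t c ψ]
  refine sum_congr rfl fun v hv => sum_congr rfl fun w hw => ?_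
  have hwB : w ∈ reps π (vBH π S H ∪ vBN π S H) := (mem_erase.1 hw).2
  obtain ⟨hσv, -⟩ := pair_inter_card_of_mixed hπ' hv
  rw [hσv]
  have hw' := hRB hwB
  have e2 : ∑ W ∈ shellIn π ((S \ {v, π v}) \ {w, π w}) t c, ψ (((W ∩ H).card : ℤ) + 1 + 1) =
      ∑ W ∈ shellIn π ((S \ {v, π v}) \ {w, π w}) t c, ψ (((W ∩ H).card : ℤ) + 2) :=
    sum_congr rfl fun W _ => by congr 1
  have e1 : ∑ W ∈ shellIn π ((S \ {v, π v}) \ {w, π w}) t c, ψ (((W ∩ H).card : ℤ) + 1 + 0) =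
      ∑ W ∈ shellIn π ((S \ {v, π v}) \ {w, π w}) t c, ψ (((W ∩ H).card : ℤ) + 1) :=
    sum_congr rfl fun W _ => by congr 1
  -- the two half terms: `{[w∈H], [πw∈H]} = {1, 0}` in some order
  rcases mem_union.1 hw' with h | h
  · simp only [vBH, mem_filter] at h
    obtain ⟨_, hwH, hπwH⟩ := h
    rw [if_pos hwH, if_neg hπwH, e1, e2]
  · simp only [vBN, mem_filter] at h
    obtain ⟨_, hwH, hπwH⟩ := h
    rw [if_neg hwH, if_pos hπwH, e1, e2]
    ring

end Excess

end ShellStep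

end Literature.Combinatorics.Optimization

end
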